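import Summits.AnomalousDissipation.AnomalousDissipation.Theorems.SawtoothPulseCascadeK3LocalisedClosureApproxBookkeepingTools
import HarnessLib

/-!
# K3loc / ApproxSol58, line `DriftFree` — helper: envelope bookkeeping, part 2 (the theorem)

Helper file of the lead prover (gen 3) for `ApproxSol58` (stmt-AnomalousDissipation-19688; parent crux K3loc
stmt-AnomalousDissipation-19492).  `envelopeBookkeeping` = the statement of stub S3 `stub_envelopeBookkeeping` of the lead's
reshaped skeleton `linear-response-lip` (evidence on 19688): GEOMETRIC-IN-PHASE envelopes of the linearised response —
`E ≤ K₂ν(j+1)M₂^{j+1}` (`L²`) and `Λ ≤ K₁ν(j+1)M₁^{j+1}` (Lipschitz) on phase `j`, with `M₂ < r := γ² − 3` and `M₁ < r²` —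
satisfy for `ν ≤ ν₀(ε, A)` the two scalar inequalities of `DriftFreeApprox.approximateSolution_of_envelopes` (p473374) up to
the horizon `T = horizon r ν A`: `∫₀ᵀ E² ≤ εν` and `(∫₀ᵗ e^{∫ₛᵗ(½Σrate+Λ)} ΛE)² ≤ εν`.  Pointwise the integrand is
`≤ e·K₁K₂ν²(J+A+1)²X^{J+A+3}`, `X = max(e^γ, M₁'M₂') < r³` (the carrier's strain between the phases of `s` and `t` costs
`e^{γ(jₜ+2−jₛ)}`, part 1 §D2, against the gain `(M₁M₂)^{jₛ+1}`); then `ν < (r²)^{-(J−1)}` (part 1 §D3) turns every bound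
into `poly(J)·qᴶ`, `q < 1` (part 1 §D4).  So, together with p473374/p475670: `K2″`-fed `L²` envelope + Lipschitz-cap-fed
Lipschitz envelope of geometric type ⇒ `ApproxSol58` — the remaining inputs are exactly stubs S1 (K2″ → `L²` envelope) and
S2 (K2Lip → Lipschitz envelope) of the reshaped line.
-/

-- `Summit.<Summit>.<Problem>`: single-conjunct summit, the duplicate namespace segment is deliberate.
set_option linter.dupNamespace false

noncomputable section

namespace Summit.AnomalousDissipation.AnomalousDissipation.Theorems.SawtoothPulseCascade.DriftFreeApprox

open MeasureTheory Set Filter Topology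
open Literature.Analysis Literature.Analysis.FunctionSpaces Literature.Analysis.FluidPDE
open Literature.Analysis.FluidPDE.SawtoothCascade
open Literature.Analysis.FluidPDE.SawtoothCascade.DriftFree

/-! ## §D5 The bookkeeping theorem (stub S3 `stub_envelopeBookkeeping` of the reshaped line `linear-response-lip`) -/

/-- **Envelope bookkeeping.**  On the box, geometric-in-phase envelopes — `0 ≤ E(t) ≤ K₂ν(j+1)M₂^{j+1}` and
`0 ≤ Λ(t) ≤ K₁ν(j+1)M₁^{j+1}` for `t ≤ T` in phase `j`, with `M₂ < γ²−3 =: r` and `M₁ < r²` — satisfy, for every lag `A`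
and `ε > 0` and all `ν ≤ ν₀(ε, A)`, the two scalar inequalities of `approximateSolution_of_envelopes` up to the horizon
`T = horizon r ν A`: `∫₀ᵀ E² ≤ εν` and `(∫₀ᵗ e^{∫ₛᵗ(½Σⱼ(rateH j+rateV j) + Λ)} Λ(s)E(s) ds)² ≤ εν` for `t ≤ T`.
(Pointwise: the integrand is `≤ e·K₁K₂ν²(J+A+1)²X^{J+A+3}`, `X = max(e^γ, M₁'M₂')`, because the carrier's strain between the
phases of `s` and `t` costs `e^{γ(jₜ+2−jₛ)}` (§D2) against the gain `(M₁M₂)^{jₛ+1}`; then `ν < (r²)^{-(J−1)}` (§D3) and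
`X < r³`, `M₂' < r`, `M₁' < r²` turn everything into `poly(J)·qᴶ`, `q < 1` (§D4).) [folklore] -/
theorem envelopeBookkeeping :
    ∀ γ ∈ Set.Icc (5 : ℝ) 8, ∀ ρN ∈ Finset.Icc 2 7, ∀ (M₁ M₂ K₁ K₂ : ℝ),
      0 ≤ M₁ → M₁ < (γ ^ 2 - 3) ^ 2 → 0 ≤ M₂ → M₂ < γ ^ 2 - 3 → 0 ≤ K₁ → 0 ≤ K₂ →
      ∀ A : ℕ, ∀ ε : ℝ, 0 < ε → ∃ ν₀ : ℝ, 0 < ν₀ ∧ ∀ ν ∈ Set.Ioc 0 ν₀, ∀ (E Λ : ℝ → ℝ),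
        ContinuousOn E (Set.Icc 0 (Literature.Analysis.FluidPDE.SawtoothCascade.DriftFree.horizon (γ ^ 2 - 3) ν A)) →
        ContinuousOn Λ (Set.Icc 0 (Literature.Analysis.FluidPDE.SawtoothCascade.DriftFree.horizon (γ ^ 2 - 3) ν A)) →
        (∀ j : ℕ, ∀ t ∈ Set.Icc 0 (Literature.Analysis.FluidPDE.SawtoothCascade.DriftFree.horizon (γ ^ 2 - 3) ν A),
          t ∈ Set.Icc (CascadeParams.tStart j) (CascadeParams.tStart (j + 1)) →
            0 ≤ E t ∧ E t ≤ K₂ * ν * ((j : ℝ) + 1) * M₂ ^ (j + 1) ∧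
            0 ≤ Λ t ∧ Λ t ≤ K₁ * ν * ((j : ℝ) + 1) * M₁ ^ (j + 1)) →
        (∫ s in (0 : ℝ)..Literature.Analysis.FluidPDE.SawtoothCascade.DriftFree.horizon (γ ^ 2 - 3) ν A, E s ^ 2)
            ≤ ε * ν ∧
        ∀ t ∈ Set.Icc 0 (Literature.Analysis.FluidPDE.SawtoothCascade.DriftFree.horizon (γ ^ 2 - 3) ν A),
          (∫ s in (0 : ℝ)..t, Real.exp (∫ τ in s..t,
              ((∑' j, (((⟨γ, 1 / 4, 2, 1, ρN⟩ : CascadeParams).rateH j τ +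
                (⟨γ, 1 / 4, 2, 1, ρN⟩ : CascadeParams).rateV j τ))) / 2 + Λ τ)) * (Λ s * E s)) ^ 2 ≤ ε * ν := by
  intro γ hγ ρN _ M₁ M₂ K₁ K₂ hM₁0 hM₁ hM₂0 hM₂ hK₁0 hK₂0 A ε hε
  set P : CascadeParams := ⟨γ, 1 / 4, 2, 1, ρN⟩ with hP
  have hγ0 : 0 ≤ P.γ := le_trans (by norm_num) hγ.1
  -- the rate `r = γ² − 3 ≥ 22` and the comparison constants
  set r : ℝ := γ ^ 2 - 3 with hr
  have hr22 : 22 ≤ r := by rw [hr]; nlinarith [hγ.1]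
  have hr1 : 1 < r := by linarith
  have hr0 : 0 < r := by linarith
  have hρ0 : 0 < r ^ 2 := by positivity
  set M₁' : ℝ := max M₁ 1 with hM₁'
  set M₂' : ℝ := max M₂ 1 with hM₂'
  set X : ℝ := max (Real.exp γ) (M₁' * M₂') with hX
  have hM₁'1 : 1 ≤ M₁' := le_max_right _ _
  have hM₂'1 : 1 ≤ M₂' := le_max_right _ _
  have hM₁le : M₁ ≤ M₁' := le_max_left _ _
  have hM₂le : M₂ ≤ M₂' := le_max_left _ _
  have hM₁'0 : 0 ≤ M₁' := zero_le_one.trans hM₁'1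
  have hM₂'0 : 0 ≤ M₂' := zero_le_one.trans hM₂'1
  have hX1 : 1 ≤ X := le_trans (one_le_mul_of_one_le_of_one_le hM₁'1 hM₂'1) (le_max_right _ _)
  have hX0 : 0 ≤ X := zero_le_one.trans hX1
  have hexpX : Real.exp γ ≤ X := le_max_left _ _
  have hMMX : M₁' * M₂' ≤ X := le_max_right _ _
  have hM₂'r : M₂' < r := max_lt hM₂ hr1
  have hM₁'r : M₁' < r ^ 2 := max_lt hM₁ (by rw [← one_pow 2]; exact pow_lt_pow_left₀ hr1 zero_le_one two_ne_zero)
  have hXr : X < r ^ 3 := by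
    refine max_lt (exp_lt_rate_cube hγ) ?_
    calc M₁' * M₂' < r ^ 2 * r := mul_lt_mul'' hM₁'r hM₂'r hM₁'0 hM₂'0
      _ = r ^ 3 := by ring
  -- the three decay rates
  have hq₁ : M₁' / r ^ 2 < 1 := (div_lt_one hρ0).2 hM₁'r
  have hq₂ : M₂' ^ 2 / r ^ 2 < 1 := (div_lt_one hρ0).2 (pow_lt_pow_left₀ hM₂'r hM₂'0 two_ne_zero)
  have hq₃ : X ^ 2 / (r ^ 2) ^ 3 < 1 := (div_lt_one (by positivity)).2 (by
    rw [← pow_mul, (by norm_num : 2 * 3 = 3 * 2), pow_mul]; exact pow_lt_pow_left₀ hXr hX0 two_ne_zero)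
  obtain ⟨N₁, hN₁⟩ := eventually_const_mul_pow_mul_pow_le (div_nonneg hM₁'0 hρ0.le) hq₁
    (mul_nonneg hK₁0 (pow_nonneg hM₁'0 (A + 2))) (A + 2) 1 zero_lt_one
  obtain ⟨N₂, hN₂⟩ := eventually_const_mul_pow_mul_pow_le (div_nonneg (sq_nonneg _) hρ0.le) hq₂
    (mul_nonneg (sq_nonneg K₂) (pow_nonneg (sq_nonneg M₂') (A + 2))) (A + 2) 2 hε
  obtain ⟨N₃, hN₃⟩ := eventually_const_mul_pow_mul_pow_le (div_nonneg (sq_nonneg _) (by positivity)) hq₃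
    (mul_nonneg (mul_nonneg (mul_nonneg (sq_nonneg (Real.exp 1)) (sq_nonneg K₁)) (sq_nonneg K₂))
      (pow_nonneg (sq_nonneg X) (A + 4))) (A + 2) 4 hε
  set N : ℕ := max N₁ (max N₂ N₃) with hN
  -- the threshold
  refine ⟨((r ^ 2) ^ (N + 1))⁻¹, by positivity, fun ν hν E Λ hEc hΛc henv => ?_⟩
  have hν0 : 0 < ν := hν.1
  have hν1 : ν < 1 := by
    have h1 : ((r ^ 2) ^ (N + 1))⁻¹ < 1 :=
      inv_lt_one_of_one_lt₀ (one_lt_pow₀ (one_lt_pow₀ hr1 two_ne_zero) (by omega))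
    exact lt_of_le_of_lt hν.2 h1
  set J : ℕ := Jrate (γ ^ 2 - 3) ν with hJ
  have hJN : N + 1 ≤ J := le_Jrate_of_le hν0 hr1 hν.2
  set n : ℕ := J - 1 with hn
  have hJn : J = n + 1 := by omega
  have hnN : N ≤ n := by omega
  have hn₁ : N₁ ≤ n := le_trans (le_max_left _ _) hnN
  have hn₂ : N₂ ≤ n := le_trans ((le_max_left _ _).trans (le_max_right _ _)) hnN
  have hn₃ : N₃ ≤ n := le_trans ((le_max_right _ _).trans (le_max_right _ _)) hnN
  have hνρ : ν * (r ^ 2) ^ n ≤ 1 := (nu_mul_pow_Jrate_lt_one hν0 hν1 hr1).le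
  -- the horizon
  set T : ℝ := Literature.Analysis.FluidPDE.SawtoothCascade.DriftFree.horizon (γ ^ 2 - 3) ν A with hT
  have hTJ : T = CascadeParams.tStart (J + A) := rfl
  have hT0 : 0 ≤ T := CascadeParams.tStart_nonneg _
  have hT1 : T < 1 := CascadeParams.tStart_lt_one _
  -- uniform envelope levels on `[0, T]`
  set Emax : ℝ := K₂ * ν * ((((n + (A + 2) : ℕ)) : ℝ)) * M₂' ^ (n + (A + 2)) with hEmax
  set Λmax : ℝ := K₁ * ν * ((((n + (A + 2) : ℕ)) : ℝ)) * M₁' ^ (n + (A + 2)) with hΛmax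
  have hcastJA : ((J : ℝ) + A + 1) = (((n + (A + 2) : ℕ)) : ℝ) := by rw [hJn]; push_cast; ring
  have hphase : ∀ τ ∈ Icc 0 T, ∃ j : ℕ, τ ∈ Icc (CascadeParams.tStart j) (CascadeParams.tStart (j + 1)) ∧ j ≤ J + A :=
    fun τ hτ => by
      obtain ⟨j, hj⟩ := exists_phase_Icc ⟨hτ.1, hτ.2.trans_lt hT1⟩
      exact ⟨j, hj, phase_le_of_le_tStart hj (hTJ ▸ hτ.2)⟩
  have hlev : ∀ {j : ℕ} {M M' K : ℝ}, j ≤ J + A → 0 ≤ M → M ≤ M' → 1 ≤ M' → 0 ≤ K →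
      K * ν * ((j : ℝ) + 1) * M ^ (j + 1) ≤ K * ν * ((((n + (A + 2) : ℕ)) : ℝ)) * M' ^ (n + (A + 2)) := by
    intro j M M' K hj hM hMM' hM'1 hK
    have h1 : ((j : ℝ) + 1) ≤ (((n + (A + 2) : ℕ)) : ℝ) := by
      rw [← hcastJA]; have : (j : ℝ) ≤ (J + A : ℕ) := by exact_mod_cast hj
      push_cast at this; linarith
    have h2 : M ^ (j + 1) ≤ M' ^ (n + (A + 2)) :=
      (pow_le_pow_left₀ hM hMM' _).trans (pow_le_pow_right₀ hM'1 (by omega))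
    have hKν : 0 ≤ K * ν := mul_nonneg hK hν0.le
    calc K * ν * ((j : ℝ) + 1) * M ^ (j + 1) ≤ K * ν * (((n + (A + 2) : ℕ)) : ℝ) * M ^ (j + 1) :=
          mul_le_mul_of_nonneg_right (mul_le_mul_of_nonneg_left h1 hKν) (pow_nonneg hM _)
      _ ≤ K * ν * (((n + (A + 2) : ℕ)) : ℝ) * M' ^ (n + (A + 2)) :=
          mul_le_mul_of_nonneg_left h2 (mul_nonneg hKν (Nat.cast_nonneg _))
  have hEb : ∀ τ ∈ Icc 0 T, 0 ≤ E τ ∧ E τ ≤ Emax := fun τ hτ => by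
    obtain ⟨j, hj, hjJ⟩ := hphase τ hτ
    obtain ⟨h0, h1, -, -⟩ := henv j τ hτ hj
    exact ⟨h0, h1.trans (hlev hjJ hM₂0 hM₂le hM₂'1 hK₂0)⟩
  have hΛb : ∀ τ ∈ Icc 0 T, 0 ≤ Λ τ ∧ Λ τ ≤ Λmax := fun τ hτ => by
    obtain ⟨j, hj, hjJ⟩ := hphase τ hτ
    obtain ⟨-, -, h0, h1⟩ := henv j τ hτ hj
    exact ⟨h0, h1.trans (hlev hjJ hM₁0 hM₁le hM₁'1 hK₁0)⟩
  -- `Λmax ≤ 1`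
  have hΛmax1 : Λmax ≤ 1 := by
    have h1 := hN₁ n hn₁
    have h2 : ν * M₁' ^ (n + (A + 2)) ≤ M₁' ^ (A + 2) * (M₁' / r ^ 2) ^ n := by
      have := pow_mul_pow_le_of_mul_pow_le_one 1 n (A + 2) hρ0 hM₁'0 hν0.le hνρ
      simpa only [pow_one] using this
    calc Λmax = K₁ * ((((n + (A + 2) : ℕ)) : ℝ)) * (ν * M₁' ^ (n + (A + 2))) := by rw [hΛmax]; ring
      _ ≤ K₁ * ((((n + (A + 2) : ℕ)) : ℝ)) * (M₁' ^ (A + 2) * (M₁' / r ^ 2) ^ n) :=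
          mul_le_mul_of_nonneg_left h2 (mul_nonneg hK₁0 (Nat.cast_nonneg _))
      _ = K₁ * M₁' ^ (A + 2) * ((((n + (A + 2) : ℕ)) : ℝ)) ^ 1 * (M₁' / r ^ 2) ^ n := by ring
      _ ≤ 1 := h1
  -- `Emax² ≤ εν`
  have hEmax : Emax ^ 2 ≤ ε * ν := by
    have h1 := hN₂ n hn₂
    have h2 : ν * (M₂' ^ 2) ^ (n + (A + 2)) ≤ (M₂' ^ 2) ^ (A + 2) * (M₂' ^ 2 / r ^ 2) ^ n := by
      have := pow_mul_pow_le_of_mul_pow_le_one 1 n (A + 2) hρ0 (sq_nonneg M₂') hν0.le hνρ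
      simpa only [pow_one] using this
    have h3 : 0 ≤ K₂ ^ 2 * ((((n + (A + 2) : ℕ)) : ℝ)) ^ 2 := by positivity
    calc Emax ^ 2 = ν * (K₂ ^ 2 * ((((n + (A + 2) : ℕ)) : ℝ)) ^ 2 * (ν * (M₂' ^ 2) ^ (n + (A + 2)))) := by
          rw [hEmax, ← pow_mul, mul_comm 2 (n + (A + 2)), pow_mul]; ring
      _ ≤ ν * (K₂ ^ 2 * ((((n + (A + 2) : ℕ)) : ℝ)) ^ 2 * ((M₂' ^ 2) ^ (A + 2) * (M₂' ^ 2 / r ^ 2) ^ n)) :=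
          mul_le_mul_of_nonneg_left (mul_le_mul_of_nonneg_left h2 h3) hν0.le
      _ = ν * (K₂ ^ 2 * (M₂' ^ 2) ^ (A + 2) * ((((n + (A + 2) : ℕ)) : ℝ)) ^ 2 * (M₂' ^ 2 / r ^ 2) ^ n) := by ring
      _ ≤ ν * ε := mul_le_mul_of_nonneg_left h1 hν0.le
      _ = ε * ν := mul_comm _ _
  -- the defect level `B = e K₁K₂ν²(J+A+1)² X^{J+A+3}` and `B² ≤ εν`
  set B : ℝ := Real.exp 1 * (K₁ * K₂ * ν ^ 2 * ((((n + (A + 2) : ℕ)) : ℝ)) ^ 2 * X ^ (n + (A + 4))) with hB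
  have hB0 : 0 ≤ B := by positivity
  have hBsq : B ^ 2 ≤ ε * ν := by
    have h1 := hN₃ n hn₃
    have h2 : ν ^ 3 * (X ^ 2) ^ (n + (A + 4)) ≤ (X ^ 2) ^ (A + 4) * (X ^ 2 / (r ^ 2) ^ 3) ^ n :=
      pow_mul_pow_le_of_mul_pow_le_one 3 n (A + 4) hρ0 (sq_nonneg X) hν0.le hνρ
    have h3 : 0 ≤ Real.exp 1 ^ 2 * K₁ ^ 2 * K₂ ^ 2 * ((((n + (A + 2) : ℕ)) : ℝ)) ^ 4 := by positivity
    calc B ^ 2 = ν * (Real.exp 1 ^ 2 * K₁ ^ 2 * K₂ ^ 2 * ((((n + (A + 2) : ℕ)) : ℝ)) ^ 4 *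
          (ν ^ 3 * (X ^ 2) ^ (n + (A + 4)))) := by
          rw [hB, ← pow_mul, mul_comm 2 (n + (A + 4)), pow_mul]; ring
      _ ≤ ν * (Real.exp 1 ^ 2 * K₁ ^ 2 * K₂ ^ 2 * ((((n + (A + 2) : ℕ)) : ℝ)) ^ 4 *
          ((X ^ 2) ^ (A + 4) * (X ^ 2 / (r ^ 2) ^ 3) ^ n)) :=
          mul_le_mul_of_nonneg_left (mul_le_mul_of_nonneg_left h2 h3) hν0.le
      _ = ν * (Real.exp 1 ^ 2 * K₁ ^ 2 * K₂ ^ 2 * (X ^ 2) ^ (A + 4) * ((((n + (A + 2) : ℕ)) : ℝ)) ^ 4 *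
          (X ^ 2 / (r ^ 2) ^ 3) ^ n) := by ring
      _ ≤ ν * ε := mul_le_mul_of_nonneg_left h1 hν0.le
      _ = ε * ν := mul_comm _ _
  refine ⟨?_, fun t ht => ?_⟩
  · -- Part 1: `∫₀ᵀ E² ≤ Emax²·T ≤ εν`
    have hpt : ∀ x ∈ Set.uIoc (0 : ℝ) T, ‖E x ^ 2‖ ≤ Emax ^ 2 := by
      intro x hx
      rw [uIoc_of_le hT0] at hx
      obtain ⟨h0, h1⟩ := hEb x ⟨hx.1.le, hx.2⟩
      rw [Real.norm_eq_abs, abs_of_nonneg (sq_nonneg _)]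
      exact pow_le_pow_left₀ h0 h1 2
    have h1 := intervalIntegral.norm_integral_le_of_norm_le_const hpt
    rw [sub_zero, abs_of_nonneg hT0] at h1
    have h2 : Emax ^ 2 * T ≤ Emax ^ 2 := mul_le_of_le_one_right (sq_nonneg Emax) hT1.le
    exact ((le_abs_self _).trans ((Real.norm_eq_abs _).symm.le.trans h1)).trans (h2.trans hEmax)
  · -- Part 2: the Duhamel–Grönwall integral is `≤ B·t ≤ B`, and `B² ≤ εν`
    obtain ⟨jt, hjt, hjtJ⟩ := hphase t ht
    have hmc : ContinuousOn (fun τ => (∑' i, (P.rateH i τ + P.rateV i τ)) / 2) (Icc 0 T) :=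
      continuousOn_rate_sum P hT1
    have hpt : ∀ s ∈ Set.uIoc (0 : ℝ) t,
        ‖Real.exp (∫ τ in s..t, ((∑' i, (P.rateH i τ + P.rateV i τ)) / 2 + Λ τ)) * (Λ s * E s)‖ ≤ B := by
      intro s hs
      rw [uIoc_of_le ht.1] at hs
      have hs' : s ∈ Icc 0 T := ⟨hs.1.le, hs.2.trans ht.2⟩
      have hst : s ≤ t := hs.2
      obtain ⟨js, hjs, hjsJ⟩ := hphase s hs'
      have hjsjt : js ≤ jt + 1 := phase_le_phase_succ hjs hjt hst
      have hsub : uIcc s t ⊆ Icc 0 T := by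
        rw [uIcc_of_le hst]; exact fun τ hτ => ⟨hs'.1.trans hτ.1, hτ.2.trans ht.2⟩
      -- the weight
      have hwm : (∫ τ in s..t, (∑' i, (P.rateH i τ + P.rateV i τ)) / 2) ≤ P.γ * (((jt + 2 - js : ℕ)) : ℝ) :=
        integral_rate_sum_le hγ0 hjs hjt hst
      have hwΛ : (∫ τ in s..t, Λ τ) ≤ Λmax := by
        have hpt' : ∀ τ ∈ Set.uIoc s t, ‖Λ τ‖ ≤ Λmax := by
          intro τ hτ
          rw [uIoc_of_le hst] at hτ
          obtain ⟨h0, h1⟩ := hΛb τ ⟨hs'.1.trans hτ.1.le, hτ.2.trans ht.2⟩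
          rw [Real.norm_eq_abs, abs_of_nonneg h0]; exact h1
        have h1 := intervalIntegral.norm_integral_le_of_norm_le_const hpt'
        have hts : |t - s| ≤ 1 := by
          rw [abs_of_nonneg (sub_nonneg.2 hst)]
          have := hs'.1; have := ht.2; linarith
        have hΛmax0 : 0 ≤ Λmax := by positivity
        calc (∫ τ in s..t, Λ τ) ≤ ‖∫ τ in s..t, Λ τ‖ := (le_abs_self _).trans (Real.norm_eq_abs _).symm.le
          _ ≤ Λmax * |t - s| := h1
          _ ≤ Λmax * 1 := mul_le_mul_of_nonneg_left hts hΛmax0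
          _ = Λmax := mul_one _
      have hw : (∫ τ in s..t, ((∑' i, (P.rateH i τ + P.rateV i τ)) / 2 + Λ τ)) ≤
          P.γ * (((jt + 2 - js : ℕ)) : ℝ) + 1 := by
        rw [intervalIntegral.integral_add ((hmc.mono hsub).intervalIntegrable) ((hΛc.mono hsub).intervalIntegrable)]
        exact add_le_add hwm (hwΛ.trans hΛmax1)
      have hexpw : Real.exp (∫ τ in s..t, ((∑' i, (P.rateH i τ + P.rateV i τ)) / 2 + Λ τ)) ≤
          Real.exp γ ^ (jt + 2 - js) * Real.exp 1 := by
        have hPγ : P.γ = γ := rfl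
        calc Real.exp (∫ τ in s..t, ((∑' i, (P.rateH i τ + P.rateV i τ)) / 2 + Λ τ))
            ≤ Real.exp (P.γ * (((jt + 2 - js : ℕ)) : ℝ) + 1) := Real.exp_le_exp.2 hw
          _ = Real.exp γ ^ (jt + 2 - js) * Real.exp 1 := by
              rw [Real.exp_add, hPγ, mul_comm γ, Real.exp_nat_mul]
      -- the envelope product at `s`
      obtain ⟨hE0, hE1, hΛ0, hΛ1⟩ := henv js s hs' hjs
      have hjs1 : ((js : ℝ) + 1) ≤ (((n + (A + 2) : ℕ)) : ℝ) := by
        rw [← hcastJA]; have : (js : ℝ) ≤ (J + A : ℕ) := by exact_mod_cast hjsJ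
        push_cast at this; linarith
      have hprod : Λ s * E s ≤ K₁ * K₂ * ν ^ 2 * ((((n + (A + 2) : ℕ)) : ℝ)) ^ 2 * (M₁' * M₂') ^ (js + 1) := by
        have h1 : Λ s ≤ K₁ * ν * ((((n + (A + 2) : ℕ)) : ℝ)) * M₁' ^ (js + 1) := by
          refine hΛ1.trans ?_
          have hKν : 0 ≤ K₁ * ν := mul_nonneg hK₁0 hν0.le
          calc K₁ * ν * ((js : ℝ) + 1) * M₁ ^ (js + 1) ≤ K₁ * ν * ((((n + (A + 2) : ℕ)) : ℝ)) * M₁ ^ (js + 1) :=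
                mul_le_mul_of_nonneg_right (mul_le_mul_of_nonneg_left hjs1 hKν) (pow_nonneg hM₁0 _)
            _ ≤ K₁ * ν * ((((n + (A + 2) : ℕ)) : ℝ)) * M₁' ^ (js + 1) :=
                mul_le_mul_of_nonneg_left (pow_le_pow_left₀ hM₁0 hM₁le _) (mul_nonneg hKν (Nat.cast_nonneg _))
        have h2 : E s ≤ K₂ * ν * ((((n + (A + 2) : ℕ)) : ℝ)) * M₂' ^ (js + 1) := by
          refine hE1.trans ?_
          have hKν : 0 ≤ K₂ * ν := mul_nonneg hK₂0 hν0.le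
          calc K₂ * ν * ((js : ℝ) + 1) * M₂ ^ (js + 1) ≤ K₂ * ν * ((((n + (A + 2) : ℕ)) : ℝ)) * M₂ ^ (js + 1) :=
                mul_le_mul_of_nonneg_right (mul_le_mul_of_nonneg_left hjs1 hKν) (pow_nonneg hM₂0 _)
            _ ≤ K₂ * ν * ((((n + (A + 2) : ℕ)) : ℝ)) * M₂' ^ (js + 1) :=
                mul_le_mul_of_nonneg_left (pow_le_pow_left₀ hM₂0 hM₂le _) (mul_nonneg hKν (Nat.cast_nonneg _))
        have h3 : 0 ≤ K₁ * ν * ((((n + (A + 2) : ℕ)) : ℝ)) * M₁' ^ (js + 1) := by positivity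
        calc Λ s * E s ≤ (K₁ * ν * ((((n + (A + 2) : ℕ)) : ℝ)) * M₁' ^ (js + 1)) *
              (K₂ * ν * ((((n + (A + 2) : ℕ)) : ℝ)) * M₂' ^ (js + 1)) := mul_le_mul h1 h2 hE0 h3
          _ = K₁ * K₂ * ν ^ 2 * ((((n + (A + 2) : ℕ)) : ℝ)) ^ 2 * (M₁' * M₂') ^ (js + 1) := by rw [mul_pow]; ring
      -- combine: `e^{γ(jt+2-js)} (M₁'M₂')^{js+1} ≤ X^{jt+3} ≤ X^{n+A+4}`
      have hXpow : Real.exp γ ^ (jt + 2 - js) * (M₁' * M₂') ^ (js + 1) ≤ X ^ (n + (A + 4)) := by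
        have h1 : Real.exp γ ^ (jt + 2 - js) ≤ X ^ (jt + 2 - js) := pow_le_pow_left₀ (Real.exp_pos γ).le hexpX _
        have h2 : (M₁' * M₂') ^ (js + 1) ≤ X ^ (js + 1) := pow_le_pow_left₀ (mul_nonneg hM₁'0 hM₂'0) hMMX _
        have h3 : (jt + 2 - js) + (js + 1) = jt + 3 := by omega
        calc Real.exp γ ^ (jt + 2 - js) * (M₁' * M₂') ^ (js + 1) ≤ X ^ (jt + 2 - js) * X ^ (js + 1) :=
              mul_le_mul h1 h2 (pow_nonneg (mul_nonneg hM₁'0 hM₂'0) _) (pow_nonneg hX0 _)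
          _ = X ^ (jt + 3) := by rw [← pow_add, h3]
          _ ≤ X ^ (n + (A + 4)) := pow_le_pow_right₀ hX1 (by omega)
      have hnn : 0 ≤ Real.exp (∫ τ in s..t, ((∑' i, (P.rateH i τ + P.rateV i τ)) / 2 + Λ τ)) * (Λ s * E s) :=
        mul_nonneg (Real.exp_pos _).le (mul_nonneg hΛ0 hE0)
      rw [Real.norm_eq_abs, abs_of_nonneg hnn]
      have hC0 : 0 ≤ K₁ * K₂ * ν ^ 2 * ((((n + (A + 2) : ℕ)) : ℝ)) ^ 2 := by positivity
      calc Real.exp (∫ τ in s..t, ((∑' i, (P.rateH i τ + P.rateV i τ)) / 2 + Λ τ)) * (Λ s * E s)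
          ≤ (Real.exp γ ^ (jt + 2 - js) * Real.exp 1) *
            (K₁ * K₂ * ν ^ 2 * ((((n + (A + 2) : ℕ)) : ℝ)) ^ 2 * (M₁' * M₂') ^ (js + 1)) :=
            mul_le_mul hexpw hprod (mul_nonneg hΛ0 hE0) (by positivity)
        _ = Real.exp 1 * (K₁ * K₂ * ν ^ 2 * ((((n + (A + 2) : ℕ)) : ℝ)) ^ 2 *
            (Real.exp γ ^ (jt + 2 - js) * (M₁' * M₂') ^ (js + 1))) := by ring
        _ ≤ Real.exp 1 * (K₁ * K₂ * ν ^ 2 * ((((n + (A + 2) : ℕ)) : ℝ)) ^ 2 * X ^ (n + (A + 4))) :=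
            mul_le_mul_of_nonneg_left (mul_le_mul_of_nonneg_left hXpow hC0) (Real.exp_pos 1).le
        _ = B := by rw [hB]
    have h1 := intervalIntegral.norm_integral_le_of_norm_le_const hpt
    rw [sub_zero, abs_of_nonneg ht.1] at h1
    have h2 : B * t ≤ B := mul_le_of_le_one_right hB0 (ht.2.trans hT1.le)
    have habs : |∫ s in (0 : ℝ)..t, Real.exp (∫ τ in s..t, ((∑' i, (P.rateH i τ + P.rateV i τ)) / 2 + Λ τ)) *
        (Λ s * E s)| ≤ B := ((Real.norm_eq_abs _).symm.le.trans h1).trans h2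
    calc (∫ s in (0 : ℝ)..t, Real.exp (∫ τ in s..t, ((∑' i, (P.rateH i τ + P.rateV i τ)) / 2 + Λ τ)) *
          (Λ s * E s)) ^ 2
        = |∫ s in (0 : ℝ)..t, Real.exp (∫ τ in s..t, ((∑' i, (P.rateH i τ + P.rateV i τ)) / 2 + Λ τ)) *
          (Λ s * E s)| ^ 2 := (sq_abs _).symm
      _ ≤ B ^ 2 := pow_le_pow_left₀ (abs_nonneg _) habs 2
      _ ≤ ε * ν := hBsq

end Summit.AnomalousDissipation.AnomalousDissipation.Theorems.SawtoothPulseCascade.DriftFreeApprox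

end
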